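import Mathlib
import Literature.Barriers.ValiantsHypothesis.AlgebraicNaturalProofs
import Literature.Computability.AlgebraicComplexity.SparseCircuitBounds
import Literature.Computability.AlgebraicComplexity.ElementarySymmetricFFT
import Literature.Computability.AlgebraicComplexity.SeparableSeriesCircuit
import HarnessLib

/-!
# Separable coefficient tensors for ARBITRARY tables at `≈ 4n² + O(n log² n)` gates
(crux stmt-ValiantsHypothesis-14610 side; docket 8745/8749 of seat val-np-p5)

**What is proved (unconditional; it does NOT close any item).** For every `n`, every `J` with
`n + 1 ≤ 2^J` and EVERY table of univariate coefficient sequences `c_l : ℕ → ℂ` (`l < n`) there is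
`Λ ∈ ℂ[x_1, …, x_n]` of total degree `≤ n` and fan-in-two size
`complexity Λ ≤ 2 n 2^J + expCost J + 2n + 2` with `coeff_μ Λ = ∏_l c_l(μ_l)` for every `|μ| ≤ n`
(`exists_separable_le`); with `J = ⌈log₂(n+1)⌉` this is `≤ 5 n²` for `n ≥ 8192`
(`separableCoeff_fast`). The tree's `SeparableCoeffThree.separableCoeff_three` gives the same
object at size `≤ n³` (the truncated-product dynamic programme); the Literature engine
`complexity_sepTrunc_le` (`SeparableSeriesCircuit.lean`: the product `∏_l g_l(x_l s)` is the
solution of `y' = W y`, computed by Newton doubling with fast multiplication) needs `c_l(0) = 1`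
and truncates at order `n` only. This file supplies the reduction of an arbitrary table to that
engine:

* `complexity_truncSum_le` — the engine with truncation at ANY order `m + 1 ≤ 2^J`
  (`Σ_{d ≤ m} [s^d] ∏_l g_l(x_l s)` in `2 n 2^J + expCost J + m` gates, `c_l(0) = 1`), with its
  coefficients (`coeff_truncSum`) and degree (`totalDegree_truncSum_le`);
* the reduction (`coeff_monomial_mul_truncSum`): if `r_l = ord g_l ≤ n` for all `l` and
  `R = Σ r_l ≤ n`, then `Λ = (∏_l c_l(r_l)) · x^r · Σ_{d ≤ n-R} [s^d] ∏_l g̃_l(x_l s)` with the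
  normalised tables `c̃_l(j) = c_l(r_l + j) / c_l(r_l)` (`c̃_l(0) = 1`); if some `g_l ≡ 0 mod y^{n+1}`
  or `R > n` then every `∏_l c_l(μ_l)`, `|μ| ≤ n`, vanishes and `Λ = 0`
  (`prod_eq_zero_of_forall_le`, `prod_eq_zero_of_degree_lt`);
* the count `2 n 2^L + expCost L + 2n + 2 ≤ 5n²` for `n ≥ 8192`, `L = ⌈log₂(n+1)⌉`
  (`sepBudget_le`), and the theorems `exists_separable_le`, `separableCoeff_fast`,
  `separableCoeff_fast'` (the `degLEMonomials` form consumed by the generator files).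

Consumers (separate files): the succinct Shpilka–Volkovich generator rows 'read-once / PROP
distinguishers', 'products of sparse distinguishers', 'level-one reduction' move from exponent `5`
(`4n` resp. `2an` seeds at `n³` each) to exponent `4` (seeds at `5n²` each). NOT lower: the
generator needs `t ≥ 2n - O(log n)` seeds and each seed's `W`-series alone costs `≈ n 2^J ≈ 2n²`.

Honest framing: 14610-side bookkeeping in FSV's regime `d = n`; nothing here bears on the open
cruxes 8745/8749 (open at `b = 2`, Chatterjee–Tengse §1.3) or on `VP ≠ VNP`.

References: [ForbesShpilkaVolk2018] Construction 25, Fact 26; [Brent1976] §§5–6;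
[Burgisser2000] Def. 2.1, Rem. 2.7.
-/

-- layout Summits/ValiantsHypothesis/ValiantsHypothesis forces the duplicated namespace component
set_option linter.dupNamespace false

noncomputable section

namespace Summit.ValiantsHypothesis.ValiantsHypothesis.Theorems.BarrierLever.SuccinctHittingSetsForVP

open Literature.Barriers.ValiantsHypothesis Literature.Computability.AlgebraicComplexity MvPolynomial

namespace SeparableCoeffFast

/-! ### A. The engine with truncation at any order -/

section Engine

universe uu

variable {k : Type uu} [CommRing k] (n : ℕ) (c : Fin n → ℕ → k)

open Finset

/-- **Truncation at any order.** For tables with `c_l(0) = 1` and `m + 1 ≤ 2^J`, the polynomial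
`Σ_{d ≤ m} [s^d] ∏_l g_l(x_l s)` has `complexity ≤ 2 n 2^J + expCost J + m` (powers `x_l^{j+1}`,
the coefficients of `W`, Newton doubling for `y' = W y`, and `m` additions) — the proof of
`complexity_sepTrunc_le` with the final sum stopped at `m`. [cite: ForbesShpilkaVolk2018, Construction 25] -/
theorem complexity_truncSum_le (ζ tinv : ℕ → k)
    (hζ : ∀ κ, κ ≠ 0 → ζ κ ^ 2 ^ (κ - 1) = -1) (ht : ∀ κ, (2 ^ κ : k) * tinv κ = 1)
    (ninv : ℕ → k) (hninv : ∀ j : ℕ, ((j : k) + 1) * ninv j = 1)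
    (hc : ∀ l, c l 0 = 1) (J m : ℕ) (hm : m + 1 ≤ 2 ^ J) :
    complexity (∑ d ∈ range (m + 1), PowerSeries.coeff d (sepProd n c)) ≤
      2 * n * 2 ^ J + expCost J + m := by
  classical
  -- adapted from `Literature.Computability.AlgebraicComplexity.complexity_sepTrunc_le`
  let u : Fin n → MvPolynomial (Fin n) k := fun l => X l
  have hu : JointlyComputed u 0 := jointlyComputed_of_inputs u (fun l => Or.inl ⟨l, rfl⟩)
  have h1 := jointlyComputed_powers n hu (fun l => l) (fun l => rfl) (2 ^ J)
  have h2 := jointlyComputed_wser n c (2 ^ J) h1 (fun p => Sum.inr p) (fun p => rfl) n le_rfl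
  have hW : ∀ j : Fin (2 ^ J), (∑ l ∈ (univ : Finset (Fin n)).filter (fun l : Fin n => l.val < n),
      MvPolynomial.C (logDerCoeff n c l j) * X l ^ ((j : ℕ) + 1)) =
        PowerSeries.coeff j (wser n c) := by
    intro j
    rw [wser, PowerSeries.coeff_mk, filter_true_of_mem (fun l _ => l.isLt)]
  have h3 := jointlyComputed_expODE ζ tinv hζ ht ninv hninv (wser n c) (sepProd n c)
    (derivativeFun_sepProd n c hc) (coeff_zero_sepProd n c hc) J _ _ (fun j => Sum.inr j) h2
    (fun j => by rw [Sum.elim_inr, hW])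
  have h4 := jointlyComputed_sum h3 (fun d => PowerSeries.coeff d (sepProd n c)) m
    (fun d => Sum.inr ⟨d, by omega⟩) (fun d => rfl)
  have := h4.complexity_le (Sum.inr ())
  have hcost : 0 + n * 2 ^ J + n * 2 ^ J + expCost J + m = 2 * n * 2 ^ J + expCost J + m := by
    ring
  rw [hcost] at this
  simpa using this

/-- `coeff_μ (Σ_{d ≤ m} [s^d] y) = ∏_l c_l(μ_l)` for `|μ| ≤ m`, else `0`.
[cite: ForbesShpilkaVolk2018, Construction 25] -/
theorem coeff_truncSum (m : ℕ) (μ : Fin n →₀ ℕ) :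
    MvPolynomial.coeff μ (∑ d ∈ range (m + 1), PowerSeries.coeff d (sepProd n c)) =
      if μ.degree ≤ m then ∏ l, c l (μ l) else 0 := by
  rw [coeff_sum]
  simp only [mvcoeff_coeff_sepProd]
  rw [sum_ite_eq]
  simp only [mem_range, Nat.lt_succ_iff]

/-- `Σ_{d ≤ m} [s^d] y` has total degree `≤ m`. [cite: ForbesShpilkaVolk2018, Construction 25] -/
theorem totalDegree_truncSum_le (m : ℕ) :
    (∑ d ∈ range (m + 1), PowerSeries.coeff d (sepProd n c)).totalDegree ≤ m := by
  rw [totalDegree]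
  refine Finset.sup_le fun μ hμ => ?_
  rw [mem_support_iff, coeff_truncSum] at hμ
  by_cases h : μ.degree ≤ m
  · have : (μ.sum fun _ e => e) = μ.degree := rfl
    rw [this]; exact h
  · exact absurd (if_neg h) hμ

end Engine

/-! ### B. The reduction of an arbitrary table -/

section Reduction

variable {n : ℕ} (c : Fin n → ℕ → ℂ)

open Finset

/-- If some sequence `c_l` vanishes on `{0, …, n}`, every `∏_l c_l(μ_l)` with `|μ| ≤ n` vanishes
(all coordinates of `μ` are `≤ n`). [folklore] -/
theorem prod_eq_zero_of_forall_le {l : Fin n} (hl : ∀ j, j ≤ n → c l j = 0) (μ : Fin n →₀ ℕ)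
    (hμ : μ.degree ≤ n) : ∏ i, c i (μ i) = 0 :=
  Finset.prod_eq_zero (Finset.mem_univ l) (hl _ ((Finsupp.le_degree l μ).trans hμ))

/-- If `c_l` vanishes below `r_l` for every `l` and `Σ_l r_l > |μ|`, then `∏_l c_l(μ_l) = 0`
(some `μ_l < r_l`). [folklore] -/
theorem prod_eq_zero_of_degree_lt (r : Fin n → ℕ) (hrlt : ∀ l j, j < r l → c l j = 0)
    (μ : Fin n →₀ ℕ) (hμ : μ.degree < ∑ l, r l) : ∏ i, c i (μ i) = 0 := by
  by_contra hne
  have hle : ∀ l, r l ≤ μ l := fun l => by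
    by_contra h
    exact hne (Finset.prod_eq_zero (Finset.mem_univ l) (hrlt l _ (not_le.mp h)))
  have : ∑ l, r l ≤ μ.degree := by
    rw [Finsupp.degree_eq_sum]
    exact Finset.sum_le_sum fun l _ => hle l
  omega

/-- The normalised tables `c̃_l(j) = c_l(r_l + j) · c_l(r_l)⁻¹` (`c̃_l(0) = 1` when
`c_l(r_l) ≠ 0`), written as a plain function. [cite: ForbesShpilkaVolk2018, Construction 25] -/
theorem normalised_zero (r : Fin n → ℕ) (hr0 : ∀ l, c l (r l) ≠ 0) (l : Fin n) :
    (fun (l : Fin n) (j : ℕ) => c l (r l + j) * (c l (r l))⁻¹) l 0 = 1 := by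
  simp only [Nat.add_zero]
  exact mul_inv_cancel₀ (hr0 l)

/-- **The reduction.** With `r_l` the order of `c_l` (`c_l(r_l) ≠ 0`, `c_l(j) = 0` for `j < r_l`),
`R = Σ r_l ≤ n`, `a = ∏_l c_l(r_l)` and the normalised tables `c̃`:
`coeff_μ (a x^r · Σ_{d ≤ n-R} [s^d] ∏_l g̃_l(x_l s)) = ∏_l c_l(μ_l)` for every `|μ| ≤ n`.
[cite: ForbesShpilkaVolk2018, Construction 25 and Fact 26] -/
theorem coeff_monomial_mul_truncSum (r : Fin n → ℕ) (hr0 : ∀ l, c l (r l) ≠ 0)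
    (hrlt : ∀ l j, j < r l → c l j = 0) (hR : ∑ l, r l ≤ n) (μ : Fin n →₀ ℕ) (hμ : μ.degree ≤ n) :
    MvPolynomial.coeff μ (monomial (Finsupp.equivFunOnFinite.symm r) (∏ l, c l (r l)) *
        ∑ d ∈ range (n - ∑ l, r l + 1), PowerSeries.coeff d
          (sepProd n (fun (l : Fin n) (j : ℕ) => c l (r l + j) * (c l (r l))⁻¹))) =
      ∏ i, c i (μ i) := by
  set rr : Fin n →₀ ℕ := Finsupp.equivFunOnFinite.symm r with hrr
  have hrr_apply : ∀ l, rr l = r l := fun l => rfl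
  have hRdeg : rr.degree = ∑ l, r l := by
    rw [Finsupp.degree_eq_sum]
    exact Finset.sum_congr rfl fun l _ => hrr_apply l
  rw [coeff_monomial_mul']
  by_cases hle : rr ≤ μ
  · rw [if_pos hle, coeff_truncSum]
    have hsplit : μ - rr + rr = μ := tsub_add_cancel_of_le hle
    have hdeg : (μ - rr).degree + rr.degree = μ.degree := by
      rw [← map_add, hsplit]
    have hdeg' : (μ - rr).degree ≤ n - ∑ l, r l := by
      rw [hRdeg] at hdeg; omega
    rw [if_pos hdeg', ← Finset.prod_mul_distrib]
    refine Finset.prod_congr rfl fun l _ => ?_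
    have hl : rr l ≤ μ l := Finsupp.le_def.mp hle l
    rw [Finsupp.tsub_apply, hrr_apply, Nat.add_sub_cancel' (by rwa [hrr_apply] at hl),
      mul_comm, mul_assoc, inv_mul_cancel₀ (hr0 l), mul_one]
  · rw [if_neg hle]
    obtain ⟨l, hl⟩ : ∃ l, μ l < r l := by
      by_contra h
      push Not at h
      exact hle (Finsupp.le_def.mpr fun l => by rw [hrr_apply]; exact h l)
    exact (Finset.prod_eq_zero (Finset.mem_univ l) (hrlt l _ hl)).symm

/-- Degree of the reduced form: `≤ R + (n - R) = n`. [cite: ForbesShpilkaVolk2018, Construction 25] -/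
theorem totalDegree_monomial_mul_truncSum_le (r : Fin n → ℕ) (hR : ∑ l, r l ≤ n) (a : ℂ)
    (c' : Fin n → ℕ → ℂ) :
    (monomial (Finsupp.equivFunOnFinite.symm r) a *
        ∑ d ∈ range (n - ∑ l, r l + 1), PowerSeries.coeff d (sepProd n c')).totalDegree ≤ n := by
  have hRdeg : ((Finsupp.equivFunOnFinite.symm r : Fin n →₀ ℕ).sum fun _ => id) = ∑ l, r l := by
    have : ((Finsupp.equivFunOnFinite.symm r : Fin n →₀ ℕ).sum fun _ => id) =
        (Finsupp.equivFunOnFinite.symm r : Fin n →₀ ℕ).degree := rfl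
    rw [this, Finsupp.degree_eq_sum]
    rfl
  calc _ ≤ (monomial (Finsupp.equivFunOnFinite.symm r) a).totalDegree +
        (∑ d ∈ range (n - ∑ l, r l + 1), PowerSeries.coeff d (sepProd n c')).totalDegree :=
        totalDegree_mul _ _
    _ ≤ (∑ l, r l) + (n - ∑ l, r l) :=
        add_le_add ((totalDegree_monomial_le _ _).trans hRdeg.le) (totalDegree_truncSum_le n c' _)
    _ = n := by omega

/-- Size of the reduced form: `≤ (2R + 1) + (2 n 2^J + expCost J + (n - R)) + 1 ≤
2 n 2^J + expCost J + 2n + 2`. [cite: Burgisser2000, Def. 2.1] -/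
theorem complexity_monomial_mul_truncSum_le (r : Fin n → ℕ) (hR : ∑ l, r l ≤ n) (a : ℂ)
    (c' : Fin n → ℕ → ℂ) (hc' : ∀ l, c' l 0 = 1) (J : ℕ) (hJ : n + 1 ≤ 2 ^ J) :
    complexity (monomial (Finsupp.equivFunOnFinite.symm r) a *
        ∑ d ∈ range (n - ∑ l, r l + 1), PowerSeries.coeff d (sepProd n c')) ≤
      2 * n * 2 ^ J + expCost J + 2 * n + 2 := by
  have hRdeg : (Finsupp.equivFunOnFinite.symm r : Fin n →₀ ℕ).degree = ∑ l, r l := by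
    rw [Finsupp.degree_eq_sum]; rfl
  have h1 : complexity (monomial (Finsupp.equivFunOnFinite.symm r) a : MvPolynomial (Fin n) ℂ) ≤
      2 * (∑ l, r l) + 1 := by
    have := complexity_monomial_le (Finsupp.equivFunOnFinite.symm r : Fin n →₀ ℕ) a
    rwa [hRdeg] at this
  have h2 := complexity_truncSum_le n c' zeta2 (fun κ => ((2 : ℂ) ^ κ)⁻¹) zeta2_pow
    (fun κ => mul_inv_cancel₀ (pow_ne_zero _ two_ne_zero)) (fun j => ((j : ℂ) + 1)⁻¹)
    (fun j => mul_inv_cancel₀ (by exact_mod_cast Nat.succ_ne_zero j)) hc' J (n - ∑ l, r l)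
    (by omega)
  have h3 := complexity_mul_le_holds
    (monomial (Finsupp.equivFunOnFinite.symm r) a : MvPolynomial (Fin n) ℂ)
    (∑ d ∈ range (n - ∑ l, r l + 1), PowerSeries.coeff d (sepProd n c'))
  omega

end Reduction

/-! ### C. The theorems -/

section Main

open Finset

/-- **Separable coefficient tensors for arbitrary tables, raw bound.** For every `n`, `J` with
`n + 1 ≤ 2^J` and every `c : Fin n → ℕ → ℂ` there is `Λ` of total degree `≤ n` and
`complexity Λ ≤ 2 n 2^J + expCost J + 2n + 2` with `coeff_μ Λ = ∏_l c_l(μ_l)` for all `|μ| ≤ n`.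
[cite: ForbesShpilkaVolk2018, Construction 25 and Fact 26] -/
theorem exists_separable_le (n J : ℕ) (hJ : n + 1 ≤ 2 ^ J) (c : Fin n → ℕ → ℂ) :
    ∃ Λ : MvPolynomial (Fin n) ℂ, Λ.totalDegree ≤ n ∧
      complexity Λ ≤ 2 * n * 2 ^ J + expCost J + 2 * n + 2 ∧
      ∀ μ : Fin n →₀ ℕ, μ.degree ≤ n → MvPolynomial.coeff μ Λ = ∏ i, c i (μ i) := by
  classical
  have hzero : ∀ (hvan : ∀ μ : Fin n →₀ ℕ, μ.degree ≤ n → ∏ i, c i (μ i) = 0),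
      ∃ Λ : MvPolynomial (Fin n) ℂ, Λ.totalDegree ≤ n ∧
        complexity Λ ≤ 2 * n * 2 ^ J + expCost J + 2 * n + 2 ∧
        ∀ μ : Fin n →₀ ℕ, μ.degree ≤ n → MvPolynomial.coeff μ Λ = ∏ i, c i (μ i) := by
    intro hvan
    refine ⟨0, by rw [totalDegree_zero]; exact Nat.zero_le _, ?_, fun μ hμ => ?_⟩
    · rw [← C_0, complexity_C_holds]; exact Nat.zero_le _
    · rw [coeff_zero, hvan μ hμ]
  by_cases hex : ∀ l : Fin n, ∃ j, c l j ≠ 0 ∧ j ≤ n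
  · -- the orders `r_l`
    let r : Fin n → ℕ := fun l => Nat.find (hex l)
    have hr0 : ∀ l, c l (r l) ≠ 0 := fun l => (Nat.find_spec (hex l)).1
    have hrn : ∀ l, r l ≤ n := fun l => (Nat.find_spec (hex l)).2
    have hrlt : ∀ l j, j < r l → c l j = 0 := fun l j hj => by
      have h := Nat.find_min (hex l) hj
      by_contra hne
      exact h ⟨hne, (le_of_lt hj).trans (hrn l)⟩
    by_cases hR : ∑ l, r l ≤ n
    · refine ⟨_, totalDegree_monomial_mul_truncSum_le r hR (∏ l, c l (r l)) _,
        complexity_monomial_mul_truncSum_le r hR (∏ l, c l (r l)) _ (normalised_zero c r hr0) J hJ,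
        fun μ hμ => coeff_monomial_mul_truncSum c r hr0 hrlt hR μ hμ⟩
    · exact hzero fun μ hμ => prod_eq_zero_of_degree_lt c r hrlt μ (by omega)
  · push Not at hex
    obtain ⟨l, hl⟩ := hex
    exact hzero fun μ hμ => prod_eq_zero_of_forall_le c
      (fun j hj => by by_contra h; exact absurd (hl j h) (not_lt.mpr hj)) μ hμ

/-- `288 L + 1009 ≤ 2^{L-1}` for `L ≥ 14`. [folklore] -/
theorem lin_le_two_pow (L : ℕ) (hL : 14 ≤ L) : 288 * L + 1009 ≤ 2 ^ (L - 1) := by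
  induction L, hL using Nat.le_induction with
  | base => norm_num
  | succ L hL ih =>
    have h3 : 2 ^ (L + 1 - 1) = 2 ^ (L - 1) * 2 := by
      rw [show L + 1 - 1 = (L - 1) + 1 by omega, pow_succ]
    rw [h3]
    omega

/-- **The count**: with `L = ⌈log₂(n+1)⌉` (`2^{L-1} ≤ n`, `2^L ≤ 2n`) and `n ≥ 8192`,
`2 n 2^L + expCost L + 2n + 2 ≤ 4n² + (72L + 251)·4n + 2n + 2 ≤ 5n²`. [folklore] -/
theorem sepBudget_le {n : ℕ} (hn : 8192 ≤ n) :
    2 * n * 2 ^ Nat.clog 2 (n + 1) + expCost (Nat.clog 2 (n + 1)) + 2 * n + 2 ≤ 5 * n ^ 2 := by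
  set L := Nat.clog 2 (n + 1) with hLdef
  have hlt : 2 ^ (L - 1) < n + 1 := by
    have := Nat.pow_pred_clog_lt_self one_lt_two (x := n + 1) (by omega)
    simpa [Nat.pred_eq_sub_one] using this
  have hpow : n + 1 ≤ 2 ^ L := Nat.le_pow_clog one_lt_two _
  have hL14 : 14 ≤ L := by
    by_contra h
    have h13 : L ≤ 13 := by omega
    have : 2 ^ L ≤ 2 ^ 13 := Nat.pow_le_pow_right (by norm_num) h13
    omega
  have h2L : 2 ^ L = 2 * 2 ^ (L - 1) := by
    rw [← pow_succ']; congr 1; omega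
  have hE := expCost_le L
  have hq := lin_le_two_pow L hL14
  have h2L1 : 2 ^ (L - 1) ≤ n := by omega
  rw [pow_succ, h2L] at hE
  rw [h2L]
  nlinarith [hE, hq, h2L1, Nat.zero_le L, Nat.zero_le (2 ^ (L - 1))]

/-- **Separable coefficient tensors for arbitrary tables at `5n²`.** For every `n ≥ 8192` and
every table `c : Fin n → ℕ → ℂ` there is `Λ` of total degree `≤ n` and `complexity Λ ≤ 5 n²` with
`coeff_μ Λ = ∏_l c_l(μ_l)` for all `|μ| ≤ n` (tree: `separableCoeff_three`, `≤ n³`, `n ≥ 6`).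
[cite: ForbesShpilkaVolk2018, Construction 25 and Fact 26] -/
theorem separableCoeff_fast {n : ℕ} (hn : 8192 ≤ n) (c : Fin n → ℕ → ℂ) :
    ∃ Λ : MvPolynomial (Fin n) ℂ, Λ.totalDegree ≤ n ∧ complexity Λ ≤ 5 * n ^ 2 ∧
      ∀ μ : Fin n →₀ ℕ, μ.degree ≤ n → MvPolynomial.coeff μ Λ = ∏ i, c i (μ i) := by
  obtain ⟨Λ, hdeg, hcx, hcoeff⟩ :=
    exists_separable_le n (Nat.clog 2 (n + 1)) (Nat.le_pow_clog one_lt_two _) c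
  exact ⟨Λ, hdeg, hcx.trans (sepBudget_le hn), hcoeff⟩

/-- The same in the `degLEMonomials` form consumed by the generator files.
[cite: ForbesShpilkaVolk2018, Construction 25 and Fact 26] -/
theorem separableCoeff_fast' {n : ℕ} (hn : 8192 ≤ n) (c : Fin n → ℕ → ℂ) :
    ∃ Λ : MvPolynomial (Fin n) ℂ, (Λ.totalDegree ≤ n ∧ complexity Λ ≤ 5 * n ^ 2) ∧
      ∀ μ : degLEMonomials n,
        MvPolynomial.coeff (μ : Fin n →₀ ℕ) Λ = ∏ i : Fin n, c i ((μ : Fin n →₀ ℕ) i) := by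
  obtain ⟨Λ, hdeg, hcx, hcoeff⟩ := separableCoeff_fast hn c
  exact ⟨Λ, ⟨hdeg, hcx⟩, fun μ => hcoeff μ μ.2⟩

/-- In particular `Λ ∈ SmallCircuits ℂ n 3` for `n ≥ 8192` (`5n² ≤ n³`), recovering
`separableCoeff_three` in that range by the fast engine. [cite: ForbesShpilkaVolk2018, Fact 26] -/
theorem separableCoeff_three_fast {n : ℕ} (hn : 8192 ≤ n) (c : Fin n → ℕ → ℂ) :
    ∃ Λ ∈ SmallCircuits ℂ n 3, ∀ μ : degLEMonomials n,
      MvPolynomial.coeff (μ : Fin n →₀ ℕ) Λ = ∏ i : Fin n, c i ((μ : Fin n →₀ ℕ) i) := by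
  obtain ⟨Λ, ⟨hdeg, hcx⟩, hcoeff⟩ := separableCoeff_fast' hn c
  refine ⟨Λ, ⟨hdeg, hcx.trans ?_⟩, hcoeff⟩
  calc 5 * n ^ 2 ≤ n * n ^ 2 := Nat.mul_le_mul_right _ (by omega)
    _ = n ^ 3 := by ring

end Main

end SeparableCoeffFast

end Summit.ValiantsHypothesis.ValiantsHypothesis.Theorems.BarrierLever.SuccinctHittingSetsForVP

end
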